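import Summits.PneNP.PneNP.Theorems.OverlapGapAlgebraNoStableSectionDefs
import Summits.PneNP.PneNP.Theses.OverlapGapAlgebra

/-!
# Crux `NoStableSection` (stmt-PneNP-2462), line `DartGame` — glue 0: stub statements, decomposition

The six registered stub STATEMENTS of the skeleton `Cruxes/NoStableSection/Lines/DartGame.lean` as
named propositions (`LadderExtraction`, `EntropyToolkit`, `CondEntCount`, `PathValidCount`,
`IndepCount`, `EnergyBound`; each `stub_<name> : <Name>` lands in its own file), the lead's stub
`Glue := LadderExtraction → … → EnergyBound → NoStableSection` (proved in `…Glue3.lean`), the list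
`KACond k` of `k`-dependent parameter inequalities, and the DECOMPOSITION
`StableValid ⊆ IndepBad ∪ OgpBad` (Bresler–Huang arXiv:2106.02129 Prop. 4.6 for an arbitrary
section, from `LadderExtraction` + `EntropyToolkit`; registered sub-goal `stub_glueDecomposition`).
Lead prover-line-stmt-PneNP-2462-0.
-/

namespace Summit.PneNP.PneNP.Cruxes.NoStableSection.DartGame

set_option linter.dupNamespace false -- `Summit.PneNP.PneNP.…`: summit = sub-problem (D-0017)

open Finset Real

/-! ## The stub statements of the line -/

/-- **Stub A — abstract ladder extraction** (BH Prop. 4.6 with Lemma 4.8 folded into the Lipschitz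
hypothesis; pure finite combinatorics, a discrete intermediate-value argument by recursion on the
rung index). A potential `h R ℓ v` ("conditional entropy of the candidate `v` given the first `ℓ`
rungs of `R`") that is local in the prefix, vanishes on repeated points, moves by `≤ δ ≤ bp - bm`
per path step, and exceeds `bp` at any time at least one window `W` after all earlier rungs,
admits `k` successive rungs inside `[bm, bp]`, each at most `W` steps after the previous one. -/
def LadderExtraction : Prop :=
  ∀ (V : Type) (k W : ℕ) (x : ℕ → V) (h : (ℕ → V) → ℕ → V → ℝ) (δ bm bp : ℝ),
    0 < W → 0 ≤ bm → δ ≤ bp - bm →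
    (∀ (R R' : ℕ → V) (ℓ : ℕ) (v : V), (∀ j < ℓ, R j = R' j) → h R ℓ v = h R' ℓ v) →
    (∀ (R : ℕ → V) (ℓ : ℕ) (v : V), (∃ j < ℓ, R j = v) → h R ℓ v = 0) →
    (∀ (R : ℕ → V) (ℓ t : ℕ), t < k * W → |h R ℓ (x (t + 1)) - h R ℓ (x t)| ≤ δ) →
    (∀ (ℓ : ℕ) (ts : ℕ → ℕ) (t : ℕ), 1 ≤ ℓ → ℓ ≤ k → (∀ j < ℓ, ts j + W ≤ t) → t ≤ k * W →
        bp < h (fun j => x (ts j)) ℓ (x t)) →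
    ∃ ts : ℕ → ℕ, ts 0 = 0 ∧ (∀ ℓ < k, ts ℓ < ts (ℓ + 1) ∧ ts (ℓ + 1) ≤ ts ℓ + W) ∧
      ∀ ℓ, 1 ≤ ℓ → ℓ ≤ k → h (fun j => x (ts j)) ℓ (x (ts ℓ)) ∈ Set.Icc bm bp

/-- **Stub B — entropy toolkit** (BH Fact 4.5 (iii) and Lemma 4.8 for the ordered conditional type
entropy): the potential vanishes on a repeated rung, and is `h₂(Δ/n)`-Lipschitz in the candidate
for Hamming distance `Δ ≤ n/2` (subadditivity + Jensen for the concave `Real.binEntropy`, via the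
conditional form `condEnt_eq_sum_binEntropy`). -/
def EntropyToolkit : Prop :=
  (∀ (n ℓ : ℕ) (R : ℕ → Fin n → Bool) (v : Fin n → Bool),
      (∃ j < ℓ, R j = v) → condEnt (withRung R ℓ v) ℓ = 0) ∧
  (∀ (n ℓ : ℕ) (R : ℕ → Fin n → Bool) (v v' : Fin n → Bool),
      (hammingDist v v' : ℝ) ≤ n / 2 →
      |condEnt (withRung R ℓ v) ℓ - condEnt (withRung R ℓ v') ℓ| ≤
        Real.binEntropy ((hammingDist v v' : ℝ) / n))

/-- **Stub C — counting by conditional type entropy** (method of types, BH §4.6 / Lemma 5.1 with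
`2^n·binom ≤ exp(n H)` EXACT): (1) for a fixed prefix, the candidates of conditional entropy `≤ b`
number at most `(n+1)^{2^ℓ} e^{nb}` (classify by the refined count vector, `Π_ξ C(N_ξ, c_ξ) ≤
exp(Σ N_ξ h₂(c_ξ/N_ξ))` by `choose_le_exp_spinRate`); (2) iterating over the rungs, the tuples
`(y⁰,…,y^L)` all of whose rungs `ℓ ≥ 1` have conditional entropy `≤ b` number at most
`2^n ((n+1)^{2^L} e^{nb})^L`. -/
def CondEntCount : Prop :=
  (∀ (n ℓ : ℕ) (R : ℕ → Fin n → Bool) (b : ℝ),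
      ((Finset.univ.filter fun v : Fin n → Bool => condEnt (withRung R ℓ v) ℓ ≤ b).card : ℝ) ≤
        ((n : ℝ) + 1) ^ (2 ^ ℓ) * Real.exp (n * b)) ∧
  (∀ (n L : ℕ) (b : ℝ), 0 ≤ b →
      ((Finset.univ.filter fun Y : Fin (L + 1) → (Fin n → Bool) =>
          ∀ ℓ : Fin (L + 1), 1 ≤ (ℓ : ℕ) → condEnt (seqOf Y) ℓ ≤ b).card : ℝ) ≤
        (2 : ℝ) ^ n * (((n : ℝ) + 1) ^ (2 ^ L) * Real.exp (n * b)) ^ L)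

/-- **Stub E — validity along the path for a fixed ladder** (BH Lemma 5.3 in counting form, no
asymptotics): for fixed times and assignments, the paths on which every `Y ℓ` violates at most `J`
clauses of the instance at time `ts ℓ` are a fraction at most
`Σ_{j ≤ (k+1)J} C(m,j) · exp(-2^{-k} · D(Y) · (m - (k+1)J - (k+1)))`, `D(Y) = energySum/n^k`:
throw out the `≤ (k+1)J` bad and `≤ k+1` interrupted clause slots; a good slot's `k+1` versions
split into independent uniform clauses `C_s = Ψ s a` (source `s_ℓ(a) = r_ℓ + [a·k+k ≤ q_ℓ]`), the
slot is a product set of the path space (`Fintype.card_piFinset`), and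
`#{C : no ℓ ∈ B falsifies C} = (2n)^k - Σ_v |{Y ℓ ∘ v : ℓ ∈ B}| ≤ (2n)^k exp(-2^{-k} x_B)` with
`Σ_s x_{B_s} ≥ D(Y)` (images of a union). -/
def PathValidCount : Prop :=
  ∀ (k m n : ℕ) (ts : Fin (k + 1) → ℕ) (Y : Fin (k + 1) → Fin n → Bool) (J : ℕ),
    1 ≤ n → (∀ ℓ, ts ℓ ≤ k * (m * k)) →
    ((Finset.univ.filter fun Ψ : PathSp k m n =>
        ∀ ℓ, violCount (Y ℓ) (instAt Ψ (ts ℓ)) ≤ J).card : ℝ) ≤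
      (∑ j ∈ Finset.range ((k + 1) * J + 1), (m.choose j : ℝ)) *
        Real.exp (-((1 / 2 : ℝ) ^ k * ((energySum (seqOf Y) k : ℝ) / (n : ℝ) ^ k) *
          ((m : ℝ) - (k + 1) * J - (k + 1)))) *
        Fintype.card (PathSp k m n)

/-- **Stub F — the one Fubini split** (BH Prop. 4.7 (ii), the single place where "`x^t` is a
function of `Φ^t`" enters): for a fixed section `g`, a time `t₀` and earlier times `ts j ≤ t₀ - mk`,
the instance `instAt Ψ t₀` reads literal coordinates of `Ψ` disjoint from all coordinates read by
the `instAt Ψ (ts j)` (hence by the earlier outputs), so the paths carrying a `J`-valid `y` of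
conditional entropy `≤ b` relative to the earlier outputs are a fraction at most
`Bc · Σ_{j≤J} C(m,j) · (1-2^{-k})^{m-J}`, where `Bc` bounds the candidate count for EVERY prefix
(supplied by Stub C) and the last two factors bound `#{Φ : violCount y Φ ≤ J}/#Φ` for each fixed
`y` (a product count over clauses: a uniform clause is falsified by `y` with probability `2^{-k}`). -/
def IndepCount : Prop :=
  ∀ (k m n : ℕ) (g : Inst m k n → Fin n → Bool) (ℓ t₀ : ℕ) (ts : Fin ℓ → ℕ) (J : ℕ) (b Bc : ℝ),
    1 ≤ n → t₀ ≤ k * (m * k) → (∀ j, ts j + m * k ≤ t₀) →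
    (∀ R : ℕ → Fin n → Bool,
      ((Finset.univ.filter fun y : Fin n → Bool => condEnt (withRung R ℓ y) ℓ ≤ b).card : ℝ) ≤
        Bc) →
    ((Finset.univ.filter fun Ψ : PathSp k m n => ∃ y : Fin n → Bool,
        violCount y (instAt Ψ t₀) ≤ J ∧
        condEnt (withRung (seqOf fun j : Fin ℓ => g (instAt Ψ (ts j))) ℓ y) ℓ ≤ b).card : ℝ) ≤
      Bc * (∑ j ∈ Finset.range (J + 1), (m.choose j : ℝ)) * (1 - (1 / 2 : ℝ) ^ k) ^ (m - J) *
        Fintype.card (PathSp k m n)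

/-- **Stub En — the energy bound** (BH Prop. 5.2 replaced by FIRST APPEARANCE + the card's
binomial-extremality small ball): `E_I |{y^ℓ[I] : ℓ ≤ k}| = 1 + Σ_{ℓ=1}^k P_I[y^ℓ[I] new]`;
conditionally on the revealed patterns the bits `y^ℓ[I]_r` are independent with laws `φ(·|ξ_r)`,
so `P[new_ℓ] ≥ P[Π_r φ(b_r|ξ_r) ≤ θ] - ℓθ ≥ 1 - P[Σ_r X_r < 1] - ℓθ` with
`X = min(-log φ, -log θ)/(-log θ) ∈ [0,1]` of mean `p ≥ (condEnt - 2θ)/(-log θ) ≥ p₀`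
(`E[u] = condEnt` by the conditional form; `E(u-L)⁺ ≤ 2θ` by `log x ≤ x - 1`), and
`P[Σ X < 1] ≤ 2(1-p)^k + kp(1-p)^{k-1}` (`dartGameSmallBall`, antitone in `p`). -/
def EnergyBound : Prop :=
  ∀ (n k : ℕ) (Y : ℕ → Fin n → Bool) (θ b p₀ : ℝ), 1 ≤ n → 1 ≤ k → 0 < θ → θ < 1 →
    2 * θ ≤ b → p₀ = (b - 2 * θ) / (-Real.log θ) →
    (∀ ℓ, 1 ≤ ℓ → ℓ ≤ k → b ≤ condEnt Y ℓ) →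
    (1 : ℝ) + k * (1 - (2 * (1 - p₀) ^ k + k * p₀ * (1 - p₀) ^ (k - 1))) -
        θ * ((k : ℝ) * (k + 1) / 2) ≤ (energySum Y k : ℝ) / (n : ℝ) ^ k

/-- **Stub G — the glue** (lead): parameters `bm = 2.6 log k/k`, `bp = 2.7 log k/k`, `η = 1/k²`,
`ν = 4^{-k}`, `θ = 1/(k log² k)`; `StableValid ⊆ IndepBad ∪ OgpBad` (Stubs A, B via
`instAt_eq_splice`); union bounds over `≤ (T+1)^{k+2}` time tuples; the two exponents
`2.7 - 5(1-ν) + 5·2^k h₂(ν) < 0` and `log 2 + log k·[2.7 - 5(1-SB_k)(1-(k+1)ν)] + O(1/log k) < 0`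
eventually in `k` (limits `SB_k → 4.6 e^{-2.6} = 0.3417`); polynomial factors absorbed eventually
in `n`; the count rewritten as the crux's filter (`StableValid` is its predicate with `P = splice`). -/
def Glue : Prop :=
  LadderExtraction → EntropyToolkit → CondEntCount → PathValidCount → IndepCount → EnergyBound →
    Summit.PneNP.PneNP.Theses.OverlapGapAlgebra.NoStableSection

/-- The parameter conditions at `k`, for the parameters `η = 1/k²`, `ν = 4^{-k}`,
`bm = 2.6 log k/k`, `bp = 2.7 log k/k`, `θ = 1/(k log² k)`, rate `L = log k/k`,
density `α = 5·2^k log k/k`. -/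
def KACond (k : ℕ) : Prop :=
  2 ≤ k ∧ (1 / (k : ℝ) ^ 2 ≤ 1 / 2) ∧
  binEntropy (1 / (k : ℝ) ^ 2) ≤ 2.7 * (Real.log k / k) - 2.6 * (Real.log k / k) ∧
  ((k : ℝ) + 1) * (1 / 4 : ℝ) ^ k ≤ 1 / 2 ∧
  1 / ((k : ℝ) * (Real.log k) ^ 2) < 1 ∧
  2 * (1 / ((k : ℝ) * (Real.log k) ^ 2)) ≤ 2.6 * (Real.log k / k) ∧
  (0 ≤ (1 : ℝ) + k * (1 - (2 * (1 - (2.6 * (Real.log k / k) - 2 * (1 / ((k : ℝ) * (Real.log k) ^ 2))) /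
      (-Real.log (1 / ((k : ℝ) * (Real.log k) ^ 2)))) ^ k +
    k * ((2.6 * (Real.log k / k) - 2 * (1 / ((k : ℝ) * (Real.log k) ^ 2))) /
      (-Real.log (1 / ((k : ℝ) * (Real.log k) ^ 2)))) *
      (1 - (2.6 * (Real.log k / k) - 2 * (1 / ((k : ℝ) * (Real.log k) ^ 2))) /
        (-Real.log (1 / ((k : ℝ) * (Real.log k) ^ 2)))) ^ (k - 1))) -
    (1 / ((k : ℝ) * (Real.log k) ^ 2)) * ((k : ℝ) * (k + 1) / 2)) ∧
  (2.7 * (Real.log k / k) + (5 * 2 ^ k * Real.log k / k) * binEntropy ((1 / 4 : ℝ) ^ k) -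
    (1 / 2 : ℝ) ^ k * (1 - (1 / 4 : ℝ) ^ k) * (5 * 2 ^ k * Real.log k / k) ≤
    -(2 * (Real.log k / k))) ∧
  (Real.log 2 + k * (2.7 * (Real.log k / k)) +
    (5 * 2 ^ k * Real.log k / k) * binEntropy (((k : ℝ) + 1) * (1 / 4 : ℝ) ^ k) -
    (1 / 2 : ℝ) ^ k * (5 * 2 ^ k * Real.log k / k) *
      ((1 : ℝ) + k * (1 - (2 * (1 - (2.6 * (Real.log k / k) - 2 * (1 / ((k : ℝ) * (Real.log k) ^ 2))) /
        (-Real.log (1 / ((k : ℝ) * (Real.log k) ^ 2)))) ^ k +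
      k * ((2.6 * (Real.log k / k) - 2 * (1 / ((k : ℝ) * (Real.log k) ^ 2))) /
        (-Real.log (1 / ((k : ℝ) * (Real.log k) ^ 2)))) *
        (1 - (2.6 * (Real.log k / k) - 2 * (1 / ((k : ℝ) * (Real.log k) ^ 2))) /
          (-Real.log (1 / ((k : ℝ) * (Real.log k) ^ 2)))) ^ (k - 1))) -
      (1 / ((k : ℝ) * (Real.log k) ^ 2)) * ((k : ℝ) * (k + 1) / 2)) *
      (1 - ((k : ℝ) + 1) * (1 / 4 : ℝ) ^ k) ≤ -(2 * (Real.log k / k)))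


/-! ## Glue, part 1: the decomposition `StableValid ⊆ IndepBad ∪ OgpBad` (BH Prop. 4.6) -/

section Decomposition

variable {k m n : ℕ}

/-- Every time `t ≤ k·(m k)` is a splice point `(r, q)` with `q ≤ m k` (for `k ≥ 1`). -/
theorem glue_exists_splice (hk : 1 ≤ k) {t : ℕ} (ht : t ≤ k * (m * k)) :
    ∃ r : Fin k, ∃ q : ℕ, q ≤ m * k ∧ t = (r : ℕ) * (m * k) + q := by
  rcases Nat.eq_zero_or_pos (m * k) with hW | hW
  · refine ⟨⟨0, hk⟩, 0, Nat.zero_le _, ?_⟩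
    rw [hW, Nat.mul_zero] at ht
    simp [hW, Nat.le_zero.1 ht]
  rcases lt_or_eq_of_le ht with hlt | rfl
  · refine ⟨⟨t / (m * k), Nat.div_lt_of_lt_mul ((Nat.mul_comm k (m * k)) ▸ hlt)⟩, t % (m * k),
      (Nat.mod_lt _ hW).le, ?_⟩
    simp only
    rw [Nat.mul_comm, Nat.div_add_mod]
  · refine ⟨⟨k - 1, by omega⟩, m * k, le_rfl, ?_⟩
    simp only
    rw [show (k - 1) * (m * k) + m * k = (k - 1 + 1) * (m * k) by ring, Nat.sub_add_cancel hk]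

/-- On the crux's event, `g` is `ν`-valid at every linear time `t ≤ k·(m k)`. -/
theorem glue_viol_instAt {g : Inst m k n → Fin n → Bool} {η ν : ℝ} {Ψ : PathSp k m n}
    (h : StableValid g η ν Ψ) (hk : 1 ≤ k) {t : ℕ} (ht : t ≤ k * (m * k)) :
    (violCount (g (instAt Ψ t)) (instAt Ψ t) : ℝ) ≤ ν * m := by
  obtain ⟨r, q, hq, rfl⟩ := glue_exists_splice hk ht
  rw [instAt_eq_splice Ψ r hq]
  exact h.1 r q hq

/-- On the crux's event, consecutive outputs along linear time move by `≤ η n`. -/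
theorem glue_dist_instAt_succ {g : Inst m k n → Fin n → Bool} {η ν : ℝ} {Ψ : PathSp k m n}
    (h : StableValid g η ν Ψ) {t : ℕ} (ht : t < k * (m * k)) :
    (hammingDist (g (instAt Ψ t)) (g (instAt Ψ (t + 1))) : ℝ) ≤ η * n := by
  have hW : 0 < m * k := Nat.pos_of_ne_zero fun h0 => by rw [h0, Nat.mul_zero] at ht; omega
  set r : ℕ := t / (m * k) with hr
  set q : ℕ := t % (m * k) with hq
  have hrk : r < k := Nat.div_lt_of_lt_mul ((Nat.mul_comm k (m * k)) ▸ ht)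
  have hqW : q < m * k := Nat.mod_lt _ hW
  have ht' : t = ((⟨r, hrk⟩ : Fin k) : ℕ) * (m * k) + q := by
    simp only; rw [hr, hq, Nat.mul_comm, Nat.div_add_mod]
  have h1 : instAt Ψ t = splice Ψ ⟨r, hrk⟩ q := by
    rw [ht']; exact instAt_eq_splice Ψ _ hqW.le
  have h2 : instAt Ψ (t + 1) = splice Ψ ⟨r, hrk⟩ (q + 1) := by
    rw [ht', add_assoc]; exact instAt_eq_splice Ψ _ hqW
  rw [h1, h2]
  exact h.2 ⟨r, hrk⟩ q hqW

/-- **The decomposition** (BH Prop. 4.6 for an arbitrary section): on the crux's event and on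
`S_indep`, the outputs of `g` along the path contain a forbidden ladder. Uses Stub A (extraction)
with the potential `h R ℓ v = condEnt (withRung R ℓ v) ℓ`, Stub B (zero on repeats; Lipschitz step
`≤ h₂(η) ≤ bp - bm`). -/
theorem glue_ogpBad_of_stableValid (hA : LadderExtraction) (hB : EntropyToolkit) (hk : 1 ≤ k)
    (hW : 0 < m * k) {η ν bm bp : ℝ} (hη : 0 ≤ η) (hη2 : η ≤ 1 / 2) (hbm : 0 ≤ bm)
    (hwin : Real.binEntropy η ≤ bp - bm) {g : Inst m k n → Fin n → Bool} {Ψ : PathSp k m n}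
    (hSV : StableValid g η ν Ψ) (hI : ¬ IndepBad g ν bp Ψ) : OgpBad k m n ν bm bp Ψ := by
  classical
  -- the data of the abstract extraction
  set x : ℕ → (Fin n → Bool) := fun t => g (instAt Ψ t) with hx
  set hpot : (ℕ → (Fin n → Bool)) → ℕ → (Fin n → Bool) → ℝ :=
    fun R ℓ v => condEnt (withRung R ℓ v) ℓ with hhpot
  -- Lipschitz step
  have hlip : ∀ (R : ℕ → Fin n → Bool) (ℓ t : ℕ), t < k * (m * k) →
      |hpot R ℓ (x (t + 1)) - hpot R ℓ (x t)| ≤ Real.binEntropy η := by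
    intro R ℓ t ht
    have hd := glue_dist_instAt_succ hSV ht
    rcases Nat.eq_zero_or_pos n with hn | hn
    · subst hn
      have : x (t + 1) = x t := funext fun i => i.elim0
      rw [this, sub_self, abs_zero]
      exact Real.binEntropy_nonneg hη (by linarith)
    have hnr : (0 : ℝ) < n := by exact_mod_cast hn
    have hdn : (hammingDist (x (t + 1)) (x t) : ℝ) / n ≤ η := by
      rw [div_le_iff₀ hnr, hammingDist_comm]; exact hd
    have hd2 : (hammingDist (x (t + 1)) (x t) : ℝ) ≤ n / 2 := by
      rw [hammingDist_comm]
      calc (hammingDist (x t) (x (t + 1)) : ℝ) ≤ η * n := hd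
        _ ≤ 1 / 2 * n := mul_le_mul_of_nonneg_right hη2 hnr.le
        _ = n / 2 := by ring
    calc |hpot R ℓ (x (t + 1)) - hpot R ℓ (x t)|
        ≤ Real.binEntropy ((hammingDist (x (t + 1)) (x t) : ℝ) / n) := hB.2 n ℓ R _ _ hd2
      _ ≤ Real.binEntropy η := by
          refine Real.binEntropy_strictMonoOn.monotoneOn ⟨by positivity, ?_⟩ ⟨hη, ?_⟩ hdn
          · exact hdn.trans (by linarith)
          · linarith
  -- the jump one sweep later (`S_indep`)
  have hjump : ∀ (ℓ : ℕ) (ts : ℕ → ℕ) (t : ℕ), 1 ≤ ℓ → ℓ ≤ k → (∀ j < ℓ, ts j + m * k ≤ t) →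
      t ≤ k * (m * k) → bp < hpot (fun j => x (ts j)) ℓ (x t) := by
    intro ℓ ts t _ hℓk hts ht
    by_contra hle
    push Not at hle
    apply hI
    refine ⟨⟨ℓ, Nat.lt_succ_of_le hℓk⟩, t, fun j => ts j, x t, ht, fun j => hts j j.isLt,
      glue_viol_instAt hSV hk ht, ?_⟩
    have hR : withRung (seqOf fun j : Fin ℓ => g (instAt Ψ (ts j))) ℓ (x t) =
        withRung (fun j => x (ts j)) ℓ (x t) :=
      withRung_congr (fun j hj => by rw [seqOf_apply_lt _ hj]) _
    simpa [hhpot, hR] using hle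
  -- run the extraction
  obtain ⟨ts, hts0, hgap, hrung⟩ := hA (Fin n → Bool) k (m * k) x hpot (Real.binEntropy η) bm bp
    hW hbm hwin (fun R R' ℓ v hRR' => condEnt_withRung_congr hRR' v)
    (fun R ℓ v hv => hB.1 n ℓ R v hv) hlip hjump
  -- times are bounded by `ℓ · (m k)`
  have hbound : ∀ ℓ ≤ k, ts ℓ ≤ ℓ * (m * k) := by
    intro ℓ hℓ
    induction ℓ with
    | zero => simp [hts0]
    | succ ℓ ih =>
      calc ts (ℓ + 1) ≤ ts ℓ + m * k := (hgap ℓ (by omega)).2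
        _ ≤ ℓ * (m * k) + m * k := Nat.add_le_add_right (ih (by omega)) _
        _ = (ℓ + 1) * (m * k) := by ring
  have hmono : ∀ i j, i ≤ j → j ≤ k → ts i ≤ ts j := by
    intro i j hij hjk
    induction j with
    | zero => simp [Nat.le_zero.1 hij]
    | succ j ih =>
      rcases Nat.lt_or_eq_of_le hij with h | h
      · exact (ih (Nat.lt_succ_iff.1 h) (by omega)).trans (hgap j (by omega)).1.le
      · rw [h]
  refine ⟨fun ℓ => ts ℓ, fun ℓ => x (ts ℓ), ?_, ?_, ?_, ?_⟩
  · intro i j hij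
    exact hmono i j hij (Nat.lt_succ_iff.1 j.isLt)
  · simpa using hbound k le_rfl
  · intro ℓ
    exact glue_viol_instAt hSV hk ((hbound ℓ (Nat.lt_succ_iff.1 ℓ.isLt)).trans
      (Nat.mul_le_mul_right _ (Nat.lt_succ_iff.1 ℓ.isLt)))
  · intro ℓ hℓ1
    have hℓk : (ℓ : ℕ) ≤ k := Nat.lt_succ_iff.1 ℓ.isLt
    have hmem := hrung ℓ hℓ1 hℓk
    have hY : condEnt (seqOf fun ℓ' : Fin (k + 1) => x (ts ℓ')) ℓ =
        hpot (fun j => x (ts j)) ℓ (x (ts ℓ)) := by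
      simp only [hhpot]
      refine condEnt_congr fun j hj => ?_
      rw [seqOf_apply_lt _ (by omega : j < k + 1)]
      rcases Nat.lt_or_eq_of_le hj with hj' | rfl
      · rw [withRung_of_lt _ _ _ hj']
      · rw [withRung_self]
    rw [hY]
    exact hmem

end Decomposition

/-! ## Registered sub-goal of this file -/

/-- **Sub-goal `stub_glueDecomposition`** (registered on stmt-PneNP-2462): the decomposition
`StableValid ⊆ IndepBad ∪ OgpBad` with the two stub statements it consumes written out. -/
theorem stub_glueDecomposition : ∀ {k m n : ℕ}, (∀ (V : Type) (k W : ℕ) (x : ℕ → V) (h : (ℕ → V) → ℕ → V → ℝ) (δ bm bp : ℝ), 0 < W → 0 ≤ bm → δ ≤ bp - bm → (∀ (R R' : ℕ → V) (ℓ : ℕ) (v : V), (∀ j < ℓ, R j = R' j) → h R ℓ v = h R' ℓ v) → (∀ (R : ℕ → V) (ℓ : ℕ) (v : V), (∃ j < ℓ, R j = v) → h R ℓ v = 0) → (∀ (R : ℕ → V) (ℓ t : ℕ), t < k * W → |h R ℓ (x (t + 1)) - h R ℓ (x t)| ≤ δ) → (∀ (ℓ : ℕ) (ts : ℕ → ℕ)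 (t : ℕ), 1 ≤ ℓ → ℓ ≤ k → (∀ j < ℓ, ts j + W ≤ t) → t ≤ k * W → bp < h (fun j => x (ts j)) ℓ (x t)) → ∃ ts : ℕ → ℕ, ts 0 = 0 ∧ (∀ ℓ < k, ts ℓ < ts (ℓ + 1) ∧ ts (ℓ + 1) ≤ ts ℓ + W) ∧ ∀ ℓ, 1 ≤ ℓ → ℓ ≤ k → h (fun j => x (ts j)) ℓ (x (ts ℓ)) ∈ Set.Icc bm bp) → ((∀ (n ℓ : ℕ) (R : ℕ → Fin n → Bool) (v : Fin n → Bool), (∃ j < ℓ, R j = v) → condEnt (withRung R ℓ v) ℓ = 0) ∧ (∀ (n ℓ : ℕ) (R : ℕ → Fin n → Bool) (v v' : Fin n → Bool), (hammingDist v v' : ℝ) ≤ n / 2 → |condEnt (withRung R ℓ v) ℓ - condEnt (withRung R ℓ v') ℓ| ≤ Real.binEntropy ((hammingDist v v' : ℝ) / n))) → 1 ≤ k → 0 < m * k → ∀ {η ν bm bp : ℝ}, 0 ≤ η → η ≤ 1 / 2 → 0 ≤ bm → Real.binEntropy η ≤ bp - bm → ∀ {g : Inst m k n → Fin n → Bool}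 {Ψ : PathSp k m n}, StableValid g η ν Ψ → ¬ IndepBad g ν bp Ψ → OgpBad k m n ν bm bp Ψ :=
  by
  intro k m n hA hB hk hW η ν bm bp hη hη2 hbm hwin g Ψ hSV hI
  exact glue_ogpBad_of_stableValid hA hB hk hW hη hη2 hbm hwin hSV hI

end Summit.PneNP.PneNP.Cruxes.NoStableSection.DartGame
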